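import Summits.BirchSwinnertonDyer.Rank1Residual.P2.TransportAtTwoShuZhai
import Summits.BirchSwinnertonDyer.Rank1Residual.P2.TwistInvarianceAtTwo
import Literature.NumberTheory.EllipticCurves.Zhai2021.TwoAdicLowerBoundTwists
import HarnessLib

/-!
# Sub-lane «bsd-p2»: `BSD(·, 2)` OF A PAIR AS AN EXPLICIT FINITE COUNT — the P2 consumers of
# Shu–Zhai 2021 Thm 4.10 (rank zero `E^{(M)}` and rank one `E^{(−pM)}`) and Zhai 2021 Thm 5.2
# (rank zero), where print gives the EXACT `2`-adic valuation of `L^{(r)}(·,1)/(Ω R)`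

HONEST FRAMING (sub-lane «bsd-p2», run/shared/lean/b2b/bsd-rank1-residual/p2/, verbatim in every
file): the target of record is the FULL Birch–Swinnerton-Dyer formula for EVERY analytic-rank `≤ 1`
`E/ℚ` at ALL primes INCLUDING `2`; the odd-prime class ledger is referee A's; the `2`-part is OPEN
(cells O1 = X5 ∖ CM and O12 = the CM corner) and under census by «bsd-p2». Census / instrument
output at `2` = EVIDENCE / conjecture items with held-out validation, NEVER a Literature fact;
certificates close PAIRS (one isogeny class, `p = 2`), never classes. This file asserts NO
arithmetic fact: its inputs are the AS-PRINTED named facts `ShuZhai2021.thm410_twoAdicValuations_of_twists`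
(p2-lit-1, p311476) and `Zhai2021.thm52_twoAdic_valuation_twists` (p2-lit-1, p311631), nothing
asserted, and modularity (`hasEntireLFunction_rat`, for `L^{(r)}(·,1) ≠ 0 ⟺ r = r_an`); all explicit
binders; NO base certificate and NO Gross–Zagier–Kolyvagin binder (the printed theorems state the
ranks and the finiteness — for Thm 4.10 the ODD ORDER — of `Ш` of the twists; the GZK-free bridge
`bsdp_iff_valuation_of_leadingLCoeff` of `P2/TransportAtTwoShuZhai.lean` §0 does the conversion).
The kernel shape here is NOT a transport: the analytic side of the pair is exact IN PRINT, so Miller's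
`BSD(·,2)` of the pair is EQUIVALENT to an explicit equation between `ord₂ ∏ c_ℓ`, `ord₂ #E(ℚ)_tor`
(and, for Zhai 5.2, `ord₂ #Ш`) of the twist — what a per-pair certificate must compute is named by
the statement (Tamagawa numbers and torsion by Tate's algorithm; for Zhai 5.2 also `#Ш[2^∞]` by
descent), not chosen by the engine. A count closes ONE pair; it never closes a class and never
recolours a cell. Nothing booked; no mark moved. Unit `b2b-bsdres-p2-typer` GEN 2 (gen-1 HANDOFF
NEXT (2); LEAD-OKS I2-8).

## Contents

* §1 SHU–ZHAI Thm 4.10 COUNT FORMS `bsdp_two_twists_iff_count_of_shuZhai410`: in the setting of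
  Thm 1.2 with all `ℓ ∣ 2N` split in `ℚ(√M)`, `p ≡ 7 (mod 8)`, odd Manin constant (`r = #Q`), print
  gives `ord₂(L(E^{(M)},1)/Ω) = r − 1`, `ord₂(L′(E^{(−pM)},1)/(Ω R)) = r`, ranks `0`/`1`, both `Ш` finite
  of ODD order; hence `BSDp WM 2 ⟺ ord₂ ∏ c_ℓ(E^{(M)}) − 2·ord₂ #E^{(M)}(ℚ)_tor = r − 1` and
  `BSDp WpM 2 ⟺ ord₂ ∏ c_ℓ(E^{(−pM)}) − 2·ord₂ #E^{(−pM)}(ℚ)_tor = r`; and the unconditional analytic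
  side `shaAn_twists_of_shuZhai410` (`#Ш_an` rational with the printed valuation, `ord₂ #Ш = 0`).
* §2 ZHAI 2021 Thm 5.2 HALF-TRANSPORT `bsdp_two_twist_iff_of_zhai52` (rank zero; `Δ_E < 0`,
  `#E(ℚ)[2] = 2`, odd Manin, `ord₂(L(E,1)/c_∞) = −1`, `M ≡ 1 (4)` square-free with prime factors in
  `𝒮`): print gives `L(E^{(M)},1) ≠ 0`, `ord₂(L(E^{(M)},1)/c_∞) = r − 1`, `E^{(M)}(ℚ)` and `Ш(E^{(M)})`
  finite; hence `r_an = 0` and `BSDp WM 2 ⟺ ord₂ #Ш(E^{(M)}) + ord₂ ∏ c_ℓ − 2·ord₂ #tor = r − 1`: the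
  analytic side is settled in print; the pair closes on the ALGEBRAIC `2`-part alone.
* Grid placement (rank AND image bits): `cells_twists_of_shuZhai` — `E^{(M)}` in `r0.*.borel.*`,
  `E^{(−pM)}` in `r1.*.borel.*`; `cell_twist_of_zhai52` — `r0.*.borel.*`; the image bit by the twist
  invariance of `Red W 2` (`P2/TwistInvarianceAtTwo.lean`) from `#E(ℚ)[2] = 2` on the base.
  Reduction and CM bits are not twist-invariant and are not pinned.

References: Shu–Zhai, J. reine angew. Math. 775 (2021) 117–143, Thm 4.10 and (fbsd) [ShuZhai2021];
Zhai, Pure Appl. Math. Q. (2025) = arXiv:2102.11798, Thm 5.2 [Zhai2021BSDExactFormulaTwists];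
Miller 2011 Def 1.1 [Miller2011LMS]; HOME/p2/LEAD-OKS.md I2-8/L-OW; HOME/p2/LIT-STATUS.md §T1 rows
T1-S4, T1-Z3.
-/

noncomputable section

open scoped Classical MatrixGroups ModularForm

open CongruenceSubgroup NumberField WeierstrassCurve Literature.NumberTheory.EllipticCurves
  Literature.NumberTheory.EllipticCurves.ModularForms
  Literature.NumberTheory.EllipticCurves.Rank1Residual
  Literature.NumberTheory.EllipticCurves.Rank1Residual.Typed

set_option autoImplicit false

namespace Summit.BirchSwinnertonDyer.Rank1Residual.P2

/-! ## §1 Shu–Zhai 2021 Thm 4.10: `BSD(·,2)` of the twists as an explicit finite count -/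

section SZ

open Literature.NumberTheory.EllipticCurves.ShuZhai2021

variable {W : WeierstrassCurve ℚ} [W.IsElliptic] [W.IsGloballyMinimal] [NeZero (W.conductorNorm ℤ)]
  {Dt : ModularParametrizationData W (W.conductorNorm ℤ)} {W' : WeierstrassCurve ℚ} {p : ℕ}
  {Q : Finset ℕ}

/-- **COUNT FORMS (Shu–Zhai 2021 Thm 4.10 at `2`; no base certificate).** In the setting of Thm 1.2
with all prime factors of `2N` split in `ℚ(√M)`, `p ≡ 7 (mod 8)` and odd Manin constant, for globally
minimal models `WM`, `WpM` of `E^{(M)}`, `E^{(−pM)}` (`r = #Q`), print gives: ranks `0`/`1` equal to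
the analytic ranks, `ord₂(L(E^{(M)},1)/Ω_{E^{(M)}}) = r − 1`,
`ord₂(L′(E^{(−pM)},1)/(Ω_{E^{(−pM)}} R(E^{(−pM)}))) = r`, and `Ш(E^{(M)})`, `Ш(E^{(−pM)})` finite of ODD
order. Hence (GZK-free bridge, modularity for `L^{(r)} ≠ 0`):
`BSD(E^{(M)},2) ⟺ ord₂ ∏ c_ℓ(E^{(M)}) − 2·ord₂ #E^{(M)}(ℚ)_tor = r − 1` and
`BSD(E^{(−pM)},2) ⟺ ord₂ ∏ c_ℓ(E^{(−pM)}) − 2·ord₂ #E^{(−pM)}(ℚ)_tor = r`.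
What a certificate for such a pair computes is thereby NAMED: Tamagawa numbers and torsion of the
twist; no `L`-value, no descent. A per-pair statement; it closes no class.
[cite: ShuZhai2021, Thm. 4.10 (arXiv:2102.11808 chunk p0013 L14–L26) and (fbsd) (p0013 L6–L12)] -/
theorem bsdp_two_twists_iff_count_of_shuZhai410 (h410 : thm410_twoAdicValuations_of_twists)
    (hmod : hasEntireLFunction_rat) (hS : Thm12Setting W Dt W' p Q)
    (hQM : AllPrimesSplitInSqrt (2 * W.conductorNorm ℤ) (∏ q ∈ Q, qStar q)) (hp8 : p % 8 = 7)
    (hc : ¬ (2 : ℤ) ∣ Dt.c)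
    {WM WpM : WeierstrassCurve ℚ} [WM.IsElliptic] [WM.IsGloballyMinimal] [WpM.IsElliptic]
    [WpM.IsGloballyMinimal]
    (hM : ∃ C : VariableChange ℚ, C • W.quadraticTwist ((∏ q ∈ Q, qStar q : ℤ) : ℚ) = WM)
    (hpM : ∃ C : VariableChange ℚ,
      C • W.quadraticTwist ((-(p : ℤ) * ∏ q ∈ Q, qStar q : ℤ) : ℚ) = WpM) :
    (BSDp WM 2 ↔
      (padicValNat 2 WM.tamagawaProduct : ℤ) - 2 * padicValNat 2 WM.torsionOrder = (Q.card : ℤ) - 1) ∧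
    (BSDp WpM 2 ↔
      (padicValNat 2 WpM.tamagawaProduct : ℤ) - 2 * padicValNat 2 WpM.torsionOrder = Q.card) := by
  obtain ⟨⟨hr0, hrk0, hr1, hrk1⟩, ⟨x, hx, hvx⟩, ⟨y, hy, hvy⟩, ⟨hfinM, hoddM, hfinpM, hoddpM⟩, -⟩ :=
    h410 W Dt W' p Q hS hQM hp8 hc WM WpM hM hpM
  haveI := hfinM
  haveI := hfinpM
  -- rank zero twist: `L(E^{(M)},1) = x Ω`, `R = 1`
  have hLM : WM.leadingLCoeff = (x : ℂ) * (WM.realPeriodRat : ℂ) * (WM.regulator : ℂ) := by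
    rw [leadingLCoeff_eq_of_analyticRank_eq_zero WM hr0, hx, WM.regulator_eq_one_of_rank_zero hrk0]
    push_cast
    ring
  have hx0 : x ≠ 0 := by
    rintro rfl
    exact ((WM.analyticRank_eq_zero_iff_holds (hmod WM)).1 hr0) (by rw [hx]; simp)
  have hy0 : y ≠ 0 := by
    rintro rfl
    exact WpM.leadingLCoeff_ne_zero_holds (hmod WpM) (by rw [hy]; simp)
  have iffM := bsdp_iff_valuation_of_leadingLCoeff WM 2 (by rw [hrk0, hr0]) hx0 hLM
  have iffpM := bsdp_iff_valuation_of_leadingLCoeff WpM 2 (by rw [hrk1, hr1]) hy0 hy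
  rw [hvx, padicValNat.eq_zero_of_not_dvd hoddM.not_two_dvd_nat, Nat.cast_zero, zero_add] at iffM
  rw [hvy, padicValNat.eq_zero_of_not_dvd hoddpM.not_two_dvd_nat, Nat.cast_zero, zero_add] at iffpM
  exact ⟨iffM.trans ⟨fun h => by linarith, fun h => by linarith⟩,
    iffpM.trans ⟨fun h => by linarith, fun h => by linarith⟩⟩

/-- **Unconditional analytic side of the Thm 4.10 pairs** (what print settles with no hypothesis on
BSD): `#Ш_an(E^{(M)})` and `#Ш_an(E^{(−pM)})` are RATIONAL with
`ord₂ #Ш_an(E^{(M)}) = (r − 1) + 2·ord₂ #tor − ord₂ ∏ c_ℓ` and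
`ord₂ #Ш_an(E^{(−pM)}) = r + 2·ord₂ #tor − ord₂ ∏ c_ℓ`, while `ord₂ #Ш = 0` on both (odd order).
[cite: ShuZhai2021, Thm. 4.10 (arXiv:2102.11808 chunk p0013 L14–L26)] -/
theorem shaAn_twists_of_shuZhai410 (h410 : thm410_twoAdicValuations_of_twists)
    (hS : Thm12Setting W Dt W' p Q)
    (hQM : AllPrimesSplitInSqrt (2 * W.conductorNorm ℤ) (∏ q ∈ Q, qStar q)) (hp8 : p % 8 = 7)
    (hc : ¬ (2 : ℤ) ∣ Dt.c)
    {WM WpM : WeierstrassCurve ℚ} [WM.IsElliptic] [WM.IsGloballyMinimal] [WpM.IsElliptic]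
    [WpM.IsGloballyMinimal]
    (hM : ∃ C : VariableChange ℚ, C • W.quadraticTwist ((∏ q ∈ Q, qStar q : ℤ) : ℚ) = WM)
    (hpM : ∃ C : VariableChange ℚ,
      C • W.quadraticTwist ((-(p : ℤ) * ∏ q ∈ Q, qStar q : ℤ) : ℚ) = WpM) :
    (∃ x : ℚ, shaAn WM = ((x * (WM.torsionOrder : ℚ) ^ 2 / (WM.tamagawaProduct : ℚ) : ℚ) : ℂ) ∧
        padicValRat 2 x = (Q.card : ℤ) - 1) ∧
    (∃ y : ℚ, shaAn WpM = ((y * (WpM.torsionOrder : ℚ) ^ 2 / (WpM.tamagawaProduct : ℚ) : ℚ) : ℂ) ∧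
        padicValRat 2 y = Q.card) ∧
    padicValNat 2 (Nat.card WM.sha) = 0 ∧ padicValNat 2 (Nat.card WpM.sha) = 0 := by
  obtain ⟨⟨hr0, hrk0, -, -⟩, ⟨x, hx, hvx⟩, ⟨y, hy, hvy⟩, ⟨-, hoddM, -, hoddpM⟩, -⟩ :=
    h410 W Dt W' p Q hS hQM hp8 hc WM WpM hM hpM
  have hLM : WM.leadingLCoeff = (x : ℂ) * (WM.realPeriodRat : ℂ) * (WM.regulator : ℂ) := by
    rw [leadingLCoeff_eq_of_analyticRank_eq_zero WM hr0, hx, WM.regulator_eq_one_of_rank_zero hrk0]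
    push_cast
    ring
  exact ⟨⟨x, shaAn_eq_of_leadingLCoeff WM hLM, hvx⟩, ⟨y, shaAn_eq_of_leadingLCoeff WpM hy, hvy⟩,
    padicValNat.eq_zero_of_not_dvd hoddM.not_two_dvd_nat, padicValNat.eq_zero_of_not_dvd hoddpM.not_two_dvd_nat⟩

/-- **Grid placement of the Shu–Zhai pairs: `E^{(M)}` in a cell `r0.*.borel.*`, `E^{(−pM)}` in a
cell `r1.*.borel.*`** — rank bits from Thm 1.2 (`rankBits_twists_of_shuZhai`), image bits from the
standing `#E(ℚ)[2] = 2` of the setting and the twist invariance of `Red` at `2`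
(`P2/TwistInvarianceAtTwo.lean`). So the rank-ONE transport of Thm 1.4 and the rank-one count of
Thm 4.10 land in the open cells `r1.<red>.borel.<cm>`. Reduction and CM bits not pinned.
[cite: ShuZhai2021, Thm. 1.2 (arXiv:2102.11808 chunk p0003 L3–L6, L24–L32)] -/
theorem cells_twists_of_shuZhai (h12 : thm12_ranks_of_twists) (hS : Thm12Setting W Dt W' p Q)
    {WM WpM : WeierstrassCurve ℚ} [WM.IsElliptic] [WM.IsGloballyMinimal] [WpM.IsElliptic]
    [WpM.IsGloballyMinimal]
    (hM : ∃ C : VariableChange ℚ, C • W.quadraticTwist ((∏ q ∈ Q, qStar q : ℤ) : ℚ) = WM)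
    (hpM : ∃ C : VariableChange ℚ,
      C • W.quadraticTwist ((-(p : ℤ) * ∏ q ∈ Q, qStar q : ℤ) : ℚ) = WpM) :
    ((cellAtTwoOf WM).r1 = false ∧ (cellAtTwoOf WM).img = .borel) ∧
      ((cellAtTwoOf WpM).r1 = true ∧ (cellAtTwoOf WpM).img = .borel) := by
  obtain ⟨hr0, hr1⟩ := rankBits_twists_of_shuZhai h12 hS hM hpM
  have h2 : Nat.card {P : W.toAffine.Point // (2 : ℕ) • P = 0} = 2 := hS.2.2.2.1
  have hQ0 : ∀ q ∈ Q, (q : ℤ) ≠ 0 := fun q hq => by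
    exact_mod_cast (hS.2.2.2.2.2.2.2.2.2 q hq).1.1.ne_zero
  have hdp := neg_p_mul_ne_zero_of_thm12Setting hS Q hQ0
  have hd : ((∏ q ∈ Q, qStar q : ℤ) : ℚ) ≠ 0 := by
    have h := hdp
    push_cast at h ⊢
    exact (mul_ne_zero_iff.mp h).2
  exact ⟨⟨hr0, img_eq_borel_of_twist_of_card_twoTorsion_eq_two W h2 hd hM⟩,
    ⟨hr1, img_eq_borel_of_twist_of_card_twoTorsion_eq_two W h2 hdp hpM⟩⟩

end SZ

/-! ## §2 Zhai 2021 Thm 5.2: the rank-zero half-transport -/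

section Zhai

open Literature.NumberTheory.EllipticCurves.Zhai2021

variable {W : WeierstrassCurve ℚ} [W.IsElliptic] [W.IsGloballyMinimal] [NeZero (W.conductorNorm ℤ)]

/-- **HALF-TRANSPORT (Zhai 2021 Thm 5.2 at `2`, rank zero; no base certificate).** Hypotheses
VERBATIM as typed by p2-lit-1 (binders): `E` optimal (`Zhai2021.IsOptimalDatum`), `Δ_E < 0`,
`#E(ℚ)[2] = 2`, odd Manin constant, `ord₂(L(E,1)/c_∞(E)) = −1`; `M` square-free, `M ≡ 1 (mod 4)`,
with a nonempty set of prime factors all in `𝒮` (`r` of them); `WM` a globally minimal model of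
`E^{(M)}`; modularity. Print gives `L(E^{(M)},1) ≠ 0`, `ord₂(L(E^{(M)},1)/c_∞(E^{(M)})) = r − 1`,
`E^{(M)}(ℚ)` and `Ш(E^{(M)})` finite. Hence `r_an(E^{(M)}) = 0` and
`BSD(E^{(M)},2) ⟺ ord₂ #Ш(E^{(M)}) + ord₂ ∏ c_ℓ(E^{(M)}) − 2·ord₂ #E^{(M)}(ℚ)_tor = r − 1`:
the analytic side is settled in print; the pair closes on the ALGEBRAIC `2`-part alone (`Ш[2^∞]` by
descent, `c_ℓ` and torsion by Tate's algorithm). A per-pair statement; it closes no class.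
[cite: Zhai2021BSDExactFormulaTwists, Thm. 5.2 (arXiv:2102.11798 chunk p0010 L80–L97)] -/
theorem bsdp_two_twist_iff_of_zhai52 (h52 : thm52_twoAdic_valuation_twists)
    (hmod : hasEntireLFunction_rat) (Dt : ModularParametrizationData W (W.conductorNorm ℤ))
    (hopt : IsOptimalDatum W Dt) (hΔ : W.Δ < 0)
    (h2 : Nat.card {P : W.toAffine.Point // (2 : ℕ) • P = 0} = 2) (hc : ¬ (2 : ℤ) ∣ Dt.c)
    (hL : ∃ x : ℚ, W.entireLFunction 1 = (x : ℂ) * (W.realPeriodRat : ℂ) ∧ padicValRat 2 x = -1)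
    (M : ℤ) (hsq : Squarefree M) (hM4 : M % 4 = 1) (hne : M.natAbs.primeFactors.Nonempty)
    (hSM : ∀ q ∈ M.natAbs.primeFactors, InS W q)
    {WM : WeierstrassCurve ℚ} [WM.IsElliptic] [WM.IsGloballyMinimal]
    (hWM : ∃ C : VariableChange ℚ, C • W.quadraticTwist (M : ℚ) = WM) :
    WM.analyticRank = 0 ∧
      (BSDp WM 2 ↔ (padicValNat 2 (Nat.card WM.sha) : ℤ) + padicValNat 2 WM.tamagawaProduct -
        2 * padicValNat 2 WM.torsionOrder = (M.natAbs.primeFactors.card : ℤ) - 1) := by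
  obtain ⟨hLne, ⟨x, hx, hvx⟩, hfinPt, hfinSha⟩ :=
    h52 W Dt hopt hΔ h2 hc hL M hsq hM4 hne hSM WM hWM
  haveI := hfinSha
  have hr0 : WM.analyticRank = 0 := (WM.analyticRank_eq_zero_iff_holds (hmod WM)).2 hLne
  have hrk0 : WM.mordellWeilRank = 0 := mordellWeilRank_eq_zero_of_finite WM hfinPt
  have hLM : WM.leadingLCoeff = (x : ℂ) * (WM.realPeriodRat : ℂ) * (WM.regulator : ℂ) := by
    rw [leadingLCoeff_eq_of_analyticRank_eq_zero WM hr0, hx, WM.regulator_eq_one_of_rank_zero hrk0]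
    push_cast
    ring
  have hx0 : x ≠ 0 := by
    rintro rfl
    exact hLne (by rw [hx]; simp)
  have iffM := bsdp_iff_valuation_of_leadingLCoeff WM 2 (by rw [hrk0, hr0]) hx0 hLM
  rw [hvx] at iffM
  exact ⟨hr0, iffM.trans ⟨fun h => by linarith, fun h => by linarith⟩⟩

/-- **Grid placement of a Zhai Thm 5.2 twist: a cell `r0.*.borel.*`** — rank bit from
`L(E^{(M)},1) ≠ 0` (print + modularity), image bit from `#E(ℚ)[2] = 2` on the base and the twist
invariance of `Red` at `2` (`P2/TwistInvarianceAtTwo.lean`; `M ≠ 0` as `M` is square-free).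
Reduction and CM bits not pinned. [cite: Zhai2021BSDExactFormulaTwists, Thm. 5.2 (arXiv:2102.11798 chunk p0010 L80–L97)] -/
theorem cell_twist_of_zhai52 (h52 : thm52_twoAdic_valuation_twists)
    (hmod : hasEntireLFunction_rat) (Dt : ModularParametrizationData W (W.conductorNorm ℤ))
    (hopt : IsOptimalDatum W Dt) (hΔ : W.Δ < 0)
    (h2 : Nat.card {P : W.toAffine.Point // (2 : ℕ) • P = 0} = 2) (hc : ¬ (2 : ℤ) ∣ Dt.c)
    (hL : ∃ x : ℚ, W.entireLFunction 1 = (x : ℂ) * (W.realPeriodRat : ℂ) ∧ padicValRat 2 x = -1)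
    (M : ℤ) (hsq : Squarefree M) (hM4 : M % 4 = 1) (hne : M.natAbs.primeFactors.Nonempty)
    (hSM : ∀ q ∈ M.natAbs.primeFactors, InS W q)
    {WM : WeierstrassCurve ℚ} [WM.IsElliptic] [WM.IsGloballyMinimal]
    (hWM : ∃ C : VariableChange ℚ, C • W.quadraticTwist (M : ℚ) = WM) :
    (cellAtTwoOf WM).r1 = false ∧ (cellAtTwoOf WM).img = .borel := by
  have hr0 := (bsdp_two_twist_iff_of_zhai52 h52 hmod Dt hopt hΔ h2 hc hL M hsq hM4 hne hSM hWM).1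
  have hM0 : (M : ℚ) ≠ 0 := by exact_mod_cast hsq.ne_zero
  refine ⟨?_, img_eq_borel_of_twist_of_card_twoTorsion_eq_two W h2 hM0 hWM⟩
  show decide (WM.analyticRank = 1) = false
  rw [decide_eq_false_iff_not]; omega

end Zhai

end Summit.BirchSwinnertonDyer.Rank1Residual.P2

end
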